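import Mathlib.Tactic.Ring
import Mathlib.Tactic.Linarith
import Mathlib.Tactic.Positivity
import Mathlib.Tactic.LinearCombination
import Mathlib.Data.Real.Basic
import Summits.HodgeConjecture.HodgeConjecture.Theorems.WeilClassTestProductFormula
import HarnessLib

/-!
# Conjecture N in format (4,2) — part 1/4: termwise cases and the pattern `E F E E F E`

Prover 2, generation 13 (hodge-weil ladder; note `run/shared/lean/b2b/hodge-weil/b2b-hweil-pv2-g13/PRODUCT-FORMULA-G13.md`).
Setting of `CONJECTURE-N.md` §1 (pv2-g9): format (4,2), real charges, centred coordinates — E-roots `(A_e, u_e)`, F-roots `(B_f, v_f)`,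
`ΣA = ΣB`, `Σu = Σv`, purity `P1 = P2 = P4 = 0`, pairwise ampleness `|u_e − v_f| ≤ A_e − B_f`; `G₀ = Q₂ + Q₄`.
From the PRODUCT FORMULA (`WeilClassTestProductFormula.G0_eq_F1/F2`): `G₀ = 2Σ_{{i,j}⊔{k,l}=E}(a_ia_j − b_ib_j)b_kb_l` relative to an F-root,
`a_e = A_e − B_f ≥ |b_e|`, `b_e = u_e − v_f`. Here: (i) `G₀ ≥ 0` whenever an F-root sees all E-charges weakly on one side (`G0_nonneg_of_F1_below`, …);
(ii) the three-line inequality `aX_sub_uW_nonneg` and with it `G₀ ≥ 0` in the charge pattern `u₁ < v₁ < u₂, u₃ < v₂ < u₄`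
(`G0_nonneg_pattern_EFEEFE`: `G₀ = 2K₂ − 12K₀`, `K₀ < 0`, and `K₂ ≥ 0` from the F-root whose `K₁` has the right sign — `K₁, K₂` agree for both
F-roots on the pure locus). Parts 2–4: `WeilClassTestFormatFourTwoWalls`, `…Sorted`, `WeilClassTestFormatFourTwo` (main theorem `conjectureN_42`).
All four files declare into the namespace `…WeilClassTestFormatFourTwo`. Pure algebra; nothing here is a case of HC, a rung or a door edge (C22);
no statement of Markman's papers is used. New cell result ⇒ Summits/.
-/

set_option linter.dupNamespace false

namespace Summit.HodgeConjecture.HodgeConjecture.WeilClassTestFormatFourTwo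

open Summit.HodgeConjecture.HodgeConjecture.WeilClassTestProductFormula


open Summit.HodgeConjecture.HodgeConjecture.WeilClassTestProductFormula
/-- `a·a' − b·b' ≥ 0` whenever `|b| ≤ a` and `|b'| ≤ a'` (the E–E coefficient of the product formula under pairwise ampleness). -/
theorem aa_sub_bb_nonneg (a a' b b' : ℝ) (h : |b| ≤ a) (h' : |b'| ≤ a') : 0 ≤ a * a' - b * b' := by
  have hb : |b| * |b'| ≤ a * a' := mul_le_mul h h' (abs_nonneg _) (le_trans (abs_nonneg _) h)
  have : b * b' ≤ |b| * |b'| := by rw [← abs_mul]; exact le_abs_self _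
  linarith

/-- The product-formula sum `Σ_{splits} (a_ia_j − b_ib_j)·b_kb_l` is `≥ 0` as soon as all six products `b_kb_l` are `≥ 0` (all `b_e` of one sign). -/
theorem splitSum_nonneg (a₁ a₂ a₃ a₄ b₁ b₂ b₃ b₄ : ℝ)
    (h₁ : |b₁| ≤ a₁) (h₂ : |b₂| ≤ a₂) (h₃ : |b₃| ≤ a₃) (h₄ : |b₄| ≤ a₄)
    (p₁₂ : 0 ≤ b₁ * b₂) (p₁₃ : 0 ≤ b₁ * b₃) (p₁₄ : 0 ≤ b₁ * b₄) (p₂₃ : 0 ≤ b₂ * b₃) (p₂₄ : 0 ≤ b₂ * b₄) (p₃₄ : 0 ≤ b₃ * b₄) :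
    0 ≤ 2 * (((a₁ * a₂ - b₁ * b₂) * (b₃ * b₄))
          + ((a₁ * a₃ - b₁ * b₃) * (b₂ * b₄))
          + ((a₁ * a₄ - b₁ * b₄) * (b₂ * b₃))
          + ((a₂ * a₃ - b₂ * b₃) * (b₁ * b₄))
          + ((a₂ * a₄ - b₂ * b₄) * (b₁ * b₃))
          + ((a₃ * a₄ - b₃ * b₄) * (b₁ * b₂))) := by
  have t₁ := mul_nonneg (aa_sub_bb_nonneg a₁ a₂ b₁ b₂ h₁ h₂) p₃₄
  have t₂ := mul_nonneg (aa_sub_bb_nonneg a₁ a₃ b₁ b₃ h₁ h₃) p₂₄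
  have t₃ := mul_nonneg (aa_sub_bb_nonneg a₁ a₄ b₁ b₄ h₁ h₄) p₂₃
  have t₄ := mul_nonneg (aa_sub_bb_nonneg a₂ a₃ b₂ b₃ h₂ h₃) p₁₄
  have t₅ := mul_nonneg (aa_sub_bb_nonneg a₂ a₄ b₂ b₄ h₂ h₄) p₁₃
  have t₆ := mul_nonneg (aa_sub_bb_nonneg a₃ a₄ b₃ b₄ h₃ h₄) p₁₂
  linarith

/-- THE THREE-LINE INEQUALITY of the pattern `E F E E F E`: for `u ≥ 0`, `b₂, b₃, b₄ > 0`, `a_e ≥ 0` and `X = a₄b₂b₃ + a₃b₂b₄ + a₂b₃b₄`,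
`W = a₃a₄b₂ + a₂a₄b₃ + a₂a₃b₄`, `B = b₂b₃b₄`: if `u·X ≤ a₁·B` (the sign condition `K₁ ≥ 0`) then `a₁X − uW ≥ 0` (`= K₂ ≥ 0`), because
`B·(a₁X − uW) ≥ u·(X² − BW)` and `X² − BW` is a sum of non-negative monomials. -/
theorem aX_sub_uW_nonneg (a₁ a₂ a₃ a₄ u b₂ b₃ b₄ : ℝ) (hu : 0 ≤ u) (h₂ : 0 < b₂) (h₃ : 0 < b₃) (h₄ : 0 < b₄)
    (ha₂ : 0 ≤ a₂) (ha₃ : 0 ≤ a₃) (ha₄ : 0 ≤ a₄)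
    (hK1 : u * (a₄ * b₂ * b₃ + a₃ * b₂ * b₄ + a₂ * b₃ * b₄) ≤ a₁ * (b₂ * b₃ * b₄)) :
    0 ≤ a₁ * (a₄ * b₂ * b₃ + a₃ * b₂ * b₄ + a₂ * b₃ * b₄) - u * (a₃ * a₄ * b₂ + a₂ * a₄ * b₃ + a₂ * a₃ * b₄) := by
  set X := a₄ * b₂ * b₃ + a₃ * b₂ * b₄ + a₂ * b₃ * b₄ with hX
  set W := a₃ * a₄ * b₂ + a₂ * a₄ * b₃ + a₂ * a₃ * b₄ with hW
  set B := b₂ * b₃ * b₄ with hB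
  have hBpos : 0 < B := by rw [hB]; positivity
  have hXnn : 0 ≤ X := by rw [hX]; positivity
  have hsq : 0 ≤ X ^ 2 - B * W := by
    have e : X ^ 2 - B * W = a₄ ^ 2 * b₂ ^ 2 * b₃ ^ 2 + a₃ ^ 2 * b₂ ^ 2 * b₄ ^ 2 + a₂ ^ 2 * b₃ ^ 2 * b₄ ^ 2
        + a₃ * a₄ * b₂ ^ 2 * b₃ * b₄ + a₂ * a₄ * b₂ * b₃ ^ 2 * b₄ + a₂ * a₃ * b₂ * b₃ * b₄ ^ 2 := by
      rw [hX, hW, hB]; ring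
    rw [e]; positivity
  have key : 0 ≤ B * (a₁ * X - u * W) := by
    have e : B * (a₁ * X - u * W) = X * (a₁ * B - u * X) + u * (X ^ 2 - B * W) := by ring
    rw [e]
    have : 0 ≤ a₁ * B - u * X := by linarith
    positivity
  have comm : (a₁ * X - u * W) * B = B * (a₁ * X - u * W) := by ring
  exact le_of_mul_le_mul_right (by linarith : 0 * B ≤ (a₁ * X - u * W) * B) hBpos

/-- CASE A (F1 below all E-charges): `G₀ ≥ 0` termwise from the product formula relative to `F1`. -/
theorem G0_nonneg_of_F1_below (A₁ A₂ A₃ A₄ B₁ B₂ u₁ u₂ u₃ u₄ v₁ v₂ : ℝ)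
    (hA : A₁ + A₂ + A₃ + A₄ = B₁ + B₂) (hC : u₁ + u₂ + u₃ + u₄ = v₁ + v₂)
    (hP1 : (A₁ ^ 2 * u₁ + A₂ ^ 2 * u₂ + A₃ ^ 2 * u₃ + A₄ ^ 2 * u₄) - (B₁ ^ 2 * v₁ + B₂ ^ 2 * v₂) = 0)
    (hP2 : (A₁ * u₁ ^ 2 + A₂ * u₂ ^ 2 + A₃ * u₃ ^ 2 + A₄ * u₄ ^ 2) - (B₁ * v₁ ^ 2 + B₂ * v₂ ^ 2) = 0)
    (hP4 : (u₁ ^ 3 + u₂ ^ 3 + u₃ ^ 3 + u₄ ^ 3) - (v₁ ^ 3 + v₂ ^ 3) = 0)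
    (m₁₁ : |u₁ - v₁| ≤ A₁ - B₁) (m₂₁ : |u₂ - v₁| ≤ A₂ - B₁) (m₃₁ : |u₃ - v₁| ≤ A₃ - B₁) (m₄₁ : |u₄ - v₁| ≤ A₄ - B₁)
    (s₁ : v₁ ≤ u₁) (s₂ : v₁ ≤ u₂) (s₃ : v₁ ≤ u₃) (s₄ : v₁ ≤ u₄) :
    0 ≤ (1 / 2) * ((A₁ ^ 2 + A₂ ^ 2 + A₃ ^ 2 + A₄ ^ 2) - (B₁ ^ 2 + B₂ ^ 2)) * ((u₁ ^ 2 + u₂ ^ 2 + u₃ ^ 2 + u₄ ^ 2) - (v₁ ^ 2 + v₂ ^ 2))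
        + ((A₁ * u₁ + A₂ * u₂ + A₃ * u₃ + A₄ * u₄) - (B₁ * v₁ + B₂ * v₂)) ^ 2
        - 3 * ((A₁ ^ 2 * u₁ ^ 2 + A₂ ^ 2 * u₂ ^ 2 + A₃ ^ 2 * u₃ ^ 2 + A₄ ^ 2 * u₄ ^ 2) - (B₁ ^ 2 * v₁ ^ 2 + B₂ ^ 2 * v₂ ^ 2))
      + (3 * ((u₁ ^ 4 + u₂ ^ 4 + u₃ ^ 4 + u₄ ^ 4) - (v₁ ^ 4 + v₂ ^ 4)) - (3 / 2) * ((u₁ ^ 2 + u₂ ^ 2 + u₃ ^ 2 + u₄ ^ 2) - (v₁ ^ 2 + v₂ ^ 2)) ^ 2) := by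
  rw [G0_eq_F1 A₁ A₂ A₃ A₄ B₁ B₂ u₁ u₂ u₃ u₄ v₁ v₂ hA hC, hP1, hP2, hP4]
  have p₁₂ : 0 ≤ (u₁ - v₁) * (u₂ - v₁) := mul_nonneg (by linarith) (by linarith)
  have p₁₃ : 0 ≤ (u₁ - v₁) * (u₃ - v₁) := mul_nonneg (by linarith) (by linarith)
  have p₁₄ : 0 ≤ (u₁ - v₁) * (u₄ - v₁) := mul_nonneg (by linarith) (by linarith)
  have p₂₃ : 0 ≤ (u₂ - v₁) * (u₃ - v₁) := mul_nonneg (by linarith) (by linarith)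
  have p₂₄ : 0 ≤ (u₂ - v₁) * (u₄ - v₁) := mul_nonneg (by linarith) (by linarith)
  have p₃₄ : 0 ≤ (u₃ - v₁) * (u₄ - v₁) := mul_nonneg (by linarith) (by linarith)
  have h := splitSum_nonneg (A₁ - B₁) (A₂ - B₁) (A₃ - B₁) (A₄ - B₁) (u₁ - v₁) (u₂ - v₁) (u₃ - v₁) (u₄ - v₁) m₁₁ m₂₁ m₃₁ m₄₁ p₁₂ p₁₃ p₁₄ p₂₃ p₂₄ p₃₄
  linarith

/-- CASE A (F1 above all E-charges): `G₀ ≥ 0` termwise from the product formula relative to `F1`. -/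
theorem G0_nonneg_of_F1_above (A₁ A₂ A₃ A₄ B₁ B₂ u₁ u₂ u₃ u₄ v₁ v₂ : ℝ)
    (hA : A₁ + A₂ + A₃ + A₄ = B₁ + B₂) (hC : u₁ + u₂ + u₃ + u₄ = v₁ + v₂)
    (hP1 : (A₁ ^ 2 * u₁ + A₂ ^ 2 * u₂ + A₃ ^ 2 * u₃ + A₄ ^ 2 * u₄) - (B₁ ^ 2 * v₁ + B₂ ^ 2 * v₂) = 0)
    (hP2 : (A₁ * u₁ ^ 2 + A₂ * u₂ ^ 2 + A₃ * u₃ ^ 2 + A₄ * u₄ ^ 2) - (B₁ * v₁ ^ 2 + B₂ * v₂ ^ 2) = 0)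
    (hP4 : (u₁ ^ 3 + u₂ ^ 3 + u₃ ^ 3 + u₄ ^ 3) - (v₁ ^ 3 + v₂ ^ 3) = 0)
    (m₁₁ : |u₁ - v₁| ≤ A₁ - B₁) (m₂₁ : |u₂ - v₁| ≤ A₂ - B₁) (m₃₁ : |u₃ - v₁| ≤ A₃ - B₁) (m₄₁ : |u₄ - v₁| ≤ A₄ - B₁)
    (s₁ : u₁ ≤ v₁) (s₂ : u₂ ≤ v₁) (s₃ : u₃ ≤ v₁) (s₄ : u₄ ≤ v₁) :
    0 ≤ (1 / 2) * ((A₁ ^ 2 + A₂ ^ 2 + A₃ ^ 2 + A₄ ^ 2) - (B₁ ^ 2 + B₂ ^ 2)) * ((u₁ ^ 2 + u₂ ^ 2 + u₃ ^ 2 + u₄ ^ 2) - (v₁ ^ 2 + v₂ ^ 2))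
        + ((A₁ * u₁ + A₂ * u₂ + A₃ * u₃ + A₄ * u₄) - (B₁ * v₁ + B₂ * v₂)) ^ 2
        - 3 * ((A₁ ^ 2 * u₁ ^ 2 + A₂ ^ 2 * u₂ ^ 2 + A₃ ^ 2 * u₃ ^ 2 + A₄ ^ 2 * u₄ ^ 2) - (B₁ ^ 2 * v₁ ^ 2 + B₂ ^ 2 * v₂ ^ 2))
      + (3 * ((u₁ ^ 4 + u₂ ^ 4 + u₃ ^ 4 + u₄ ^ 4) - (v₁ ^ 4 + v₂ ^ 4)) - (3 / 2) * ((u₁ ^ 2 + u₂ ^ 2 + u₃ ^ 2 + u₄ ^ 2) - (v₁ ^ 2 + v₂ ^ 2)) ^ 2) := by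
  rw [G0_eq_F1 A₁ A₂ A₃ A₄ B₁ B₂ u₁ u₂ u₃ u₄ v₁ v₂ hA hC, hP1, hP2, hP4]
  have p₁₂ : 0 ≤ (u₁ - v₁) * (u₂ - v₁) := mul_nonneg_of_nonpos_of_nonpos (by linarith) (by linarith)
  have p₁₃ : 0 ≤ (u₁ - v₁) * (u₃ - v₁) := mul_nonneg_of_nonpos_of_nonpos (by linarith) (by linarith)
  have p₁₄ : 0 ≤ (u₁ - v₁) * (u₄ - v₁) := mul_nonneg_of_nonpos_of_nonpos (by linarith) (by linarith)
  have p₂₃ : 0 ≤ (u₂ - v₁) * (u₃ - v₁) := mul_nonneg_of_nonpos_of_nonpos (by linarith) (by linarith)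
  have p₂₄ : 0 ≤ (u₂ - v₁) * (u₄ - v₁) := mul_nonneg_of_nonpos_of_nonpos (by linarith) (by linarith)
  have p₃₄ : 0 ≤ (u₃ - v₁) * (u₄ - v₁) := mul_nonneg_of_nonpos_of_nonpos (by linarith) (by linarith)
  have h := splitSum_nonneg (A₁ - B₁) (A₂ - B₁) (A₃ - B₁) (A₄ - B₁) (u₁ - v₁) (u₂ - v₁) (u₃ - v₁) (u₄ - v₁) m₁₁ m₂₁ m₃₁ m₄₁ p₁₂ p₁₃ p₁₄ p₂₃ p₂₄ p₃₄
  linarith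

/-- CASE A (F2 below all E-charges): `G₀ ≥ 0` termwise from the product formula relative to `F2`. -/
theorem G0_nonneg_of_F2_below (A₁ A₂ A₃ A₄ B₁ B₂ u₁ u₂ u₃ u₄ v₁ v₂ : ℝ)
    (hA : A₁ + A₂ + A₃ + A₄ = B₁ + B₂) (hC : u₁ + u₂ + u₃ + u₄ = v₁ + v₂)
    (hP1 : (A₁ ^ 2 * u₁ + A₂ ^ 2 * u₂ + A₃ ^ 2 * u₃ + A₄ ^ 2 * u₄) - (B₁ ^ 2 * v₁ + B₂ ^ 2 * v₂) = 0)
    (hP2 : (A₁ * u₁ ^ 2 + A₂ * u₂ ^ 2 + A₃ * u₃ ^ 2 + A₄ * u₄ ^ 2) - (B₁ * v₁ ^ 2 + B₂ * v₂ ^ 2) = 0)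
    (hP4 : (u₁ ^ 3 + u₂ ^ 3 + u₃ ^ 3 + u₄ ^ 3) - (v₁ ^ 3 + v₂ ^ 3) = 0)
    (m₁₂ : |u₁ - v₂| ≤ A₁ - B₂) (m₂₂ : |u₂ - v₂| ≤ A₂ - B₂) (m₃₂ : |u₃ - v₂| ≤ A₃ - B₂) (m₄₂ : |u₄ - v₂| ≤ A₄ - B₂)
    (s₁ : v₂ ≤ u₁) (s₂ : v₂ ≤ u₂) (s₃ : v₂ ≤ u₃) (s₄ : v₂ ≤ u₄) :
    0 ≤ (1 / 2) * ((A₁ ^ 2 + A₂ ^ 2 + A₃ ^ 2 + A₄ ^ 2) - (B₁ ^ 2 + B₂ ^ 2)) * ((u₁ ^ 2 + u₂ ^ 2 + u₃ ^ 2 + u₄ ^ 2) - (v₁ ^ 2 + v₂ ^ 2))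
        + ((A₁ * u₁ + A₂ * u₂ + A₃ * u₃ + A₄ * u₄) - (B₁ * v₁ + B₂ * v₂)) ^ 2
        - 3 * ((A₁ ^ 2 * u₁ ^ 2 + A₂ ^ 2 * u₂ ^ 2 + A₃ ^ 2 * u₃ ^ 2 + A₄ ^ 2 * u₄ ^ 2) - (B₁ ^ 2 * v₁ ^ 2 + B₂ ^ 2 * v₂ ^ 2))
      + (3 * ((u₁ ^ 4 + u₂ ^ 4 + u₃ ^ 4 + u₄ ^ 4) - (v₁ ^ 4 + v₂ ^ 4)) - (3 / 2) * ((u₁ ^ 2 + u₂ ^ 2 + u₃ ^ 2 + u₄ ^ 2) - (v₁ ^ 2 + v₂ ^ 2)) ^ 2) := by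
  rw [G0_eq_F2 A₁ A₂ A₃ A₄ B₁ B₂ u₁ u₂ u₃ u₄ v₁ v₂ hA hC, hP1, hP2, hP4]
  have p₁₂ : 0 ≤ (u₁ - v₂) * (u₂ - v₂) := mul_nonneg (by linarith) (by linarith)
  have p₁₃ : 0 ≤ (u₁ - v₂) * (u₃ - v₂) := mul_nonneg (by linarith) (by linarith)
  have p₁₄ : 0 ≤ (u₁ - v₂) * (u₄ - v₂) := mul_nonneg (by linarith) (by linarith)
  have p₂₃ : 0 ≤ (u₂ - v₂) * (u₃ - v₂) := mul_nonneg (by linarith) (by linarith)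
  have p₂₄ : 0 ≤ (u₂ - v₂) * (u₄ - v₂) := mul_nonneg (by linarith) (by linarith)
  have p₃₄ : 0 ≤ (u₃ - v₂) * (u₄ - v₂) := mul_nonneg (by linarith) (by linarith)
  have h := splitSum_nonneg (A₁ - B₂) (A₂ - B₂) (A₃ - B₂) (A₄ - B₂) (u₁ - v₂) (u₂ - v₂) (u₃ - v₂) (u₄ - v₂) m₁₂ m₂₂ m₃₂ m₄₂ p₁₂ p₁₃ p₁₄ p₂₃ p₂₄ p₃₄
  linarith

/-- CASE A (F2 above all E-charges): `G₀ ≥ 0` termwise from the product formula relative to `F2`. -/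
theorem G0_nonneg_of_F2_above (A₁ A₂ A₃ A₄ B₁ B₂ u₁ u₂ u₃ u₄ v₁ v₂ : ℝ)
    (hA : A₁ + A₂ + A₃ + A₄ = B₁ + B₂) (hC : u₁ + u₂ + u₃ + u₄ = v₁ + v₂)
    (hP1 : (A₁ ^ 2 * u₁ + A₂ ^ 2 * u₂ + A₃ ^ 2 * u₃ + A₄ ^ 2 * u₄) - (B₁ ^ 2 * v₁ + B₂ ^ 2 * v₂) = 0)
    (hP2 : (A₁ * u₁ ^ 2 + A₂ * u₂ ^ 2 + A₃ * u₃ ^ 2 + A₄ * u₄ ^ 2) - (B₁ * v₁ ^ 2 + B₂ * v₂ ^ 2) = 0)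
    (hP4 : (u₁ ^ 3 + u₂ ^ 3 + u₃ ^ 3 + u₄ ^ 3) - (v₁ ^ 3 + v₂ ^ 3) = 0)
    (m₁₂ : |u₁ - v₂| ≤ A₁ - B₂) (m₂₂ : |u₂ - v₂| ≤ A₂ - B₂) (m₃₂ : |u₃ - v₂| ≤ A₃ - B₂) (m₄₂ : |u₄ - v₂| ≤ A₄ - B₂)
    (s₁ : u₁ ≤ v₂) (s₂ : u₂ ≤ v₂) (s₃ : u₃ ≤ v₂) (s₄ : u₄ ≤ v₂) :
    0 ≤ (1 / 2) * ((A₁ ^ 2 + A₂ ^ 2 + A₃ ^ 2 + A₄ ^ 2) - (B₁ ^ 2 + B₂ ^ 2)) * ((u₁ ^ 2 + u₂ ^ 2 + u₃ ^ 2 + u₄ ^ 2) - (v₁ ^ 2 + v₂ ^ 2))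
        + ((A₁ * u₁ + A₂ * u₂ + A₃ * u₃ + A₄ * u₄) - (B₁ * v₁ + B₂ * v₂)) ^ 2
        - 3 * ((A₁ ^ 2 * u₁ ^ 2 + A₂ ^ 2 * u₂ ^ 2 + A₃ ^ 2 * u₃ ^ 2 + A₄ ^ 2 * u₄ ^ 2) - (B₁ ^ 2 * v₁ ^ 2 + B₂ ^ 2 * v₂ ^ 2))
      + (3 * ((u₁ ^ 4 + u₂ ^ 4 + u₃ ^ 4 + u₄ ^ 4) - (v₁ ^ 4 + v₂ ^ 4)) - (3 / 2) * ((u₁ ^ 2 + u₂ ^ 2 + u₃ ^ 2 + u₄ ^ 2) - (v₁ ^ 2 + v₂ ^ 2)) ^ 2) := by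
  rw [G0_eq_F2 A₁ A₂ A₃ A₄ B₁ B₂ u₁ u₂ u₃ u₄ v₁ v₂ hA hC, hP1, hP2, hP4]
  have p₁₂ : 0 ≤ (u₁ - v₂) * (u₂ - v₂) := mul_nonneg_of_nonpos_of_nonpos (by linarith) (by linarith)
  have p₁₃ : 0 ≤ (u₁ - v₂) * (u₃ - v₂) := mul_nonneg_of_nonpos_of_nonpos (by linarith) (by linarith)
  have p₁₄ : 0 ≤ (u₁ - v₂) * (u₄ - v₂) := mul_nonneg_of_nonpos_of_nonpos (by linarith) (by linarith)
  have p₂₃ : 0 ≤ (u₂ - v₂) * (u₃ - v₂) := mul_nonneg_of_nonpos_of_nonpos (by linarith) (by linarith)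
  have p₂₄ : 0 ≤ (u₂ - v₂) * (u₄ - v₂) := mul_nonneg_of_nonpos_of_nonpos (by linarith) (by linarith)
  have p₃₄ : 0 ≤ (u₃ - v₂) * (u₄ - v₂) := mul_nonneg_of_nonpos_of_nonpos (by linarith) (by linarith)
  have h := splitSum_nonneg (A₁ - B₂) (A₂ - B₂) (A₃ - B₂) (A₄ - B₂) (u₁ - v₂) (u₂ - v₂) (u₃ - v₂) (u₄ - v₂) m₁₂ m₂₂ m₃₂ m₄₂ p₁₂ p₁₃ p₁₄ p₂₃ p₂₄ p₃₄
  linarith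


set_option maxHeartbeats 400000 in
/-- PATTERN `E F E E F E` (charges `u₁ < v₁ < u₂, u₃ < v₂ < u₄`): `G₀ ≥ 0`. On the pure locus `G₀ = 2K₂ − 12K₀` relative to either F-root
with `K₀ = ∏_e b_e < 0`; if `K₁(F₁) ≥ 0` then `K₂(F₁) ≥ 0` by `aX_sub_uW_nonneg` from `F₁` (lone E-charge below), else `K₁(F₂) = K₁(F₁) < 0` and
`K₂(F₂) ≥ 0` by the same lemma from `F₂` (lone E-charge above). Only dominance (`a_e ≥ 0`) is used, not the full ampleness. -/
theorem G0_nonneg_pattern_EFEEFE (A₁ A₂ A₃ A₄ B₁ B₂ u₁ u₂ u₃ u₄ v₁ v₂ : ℝ)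
    (hA : A₁ + A₂ + A₃ + A₄ = B₁ + B₂) (hC : u₁ + u₂ + u₃ + u₄ = v₁ + v₂)
    (hP1 : (A₁ ^ 2 * u₁ + A₂ ^ 2 * u₂ + A₃ ^ 2 * u₃ + A₄ ^ 2 * u₄) - (B₁ ^ 2 * v₁ + B₂ ^ 2 * v₂) = 0)
    (hP2 : (A₁ * u₁ ^ 2 + A₂ * u₂ ^ 2 + A₃ * u₃ ^ 2 + A₄ * u₄ ^ 2) - (B₁ * v₁ ^ 2 + B₂ * v₂ ^ 2) = 0)
    (hP4 : (u₁ ^ 3 + u₂ ^ 3 + u₃ ^ 3 + u₄ ^ 3) - (v₁ ^ 3 + v₂ ^ 3) = 0)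
    (m₁₁ : |u₁ - v₁| ≤ A₁ - B₁) (m₂₁ : |u₂ - v₁| ≤ A₂ - B₁) (m₃₁ : |u₃ - v₁| ≤ A₃ - B₁) (m₄₁ : |u₄ - v₁| ≤ A₄ - B₁)
    (m₁₂ : |u₁ - v₂| ≤ A₁ - B₂) (m₂₂ : |u₂ - v₂| ≤ A₂ - B₂) (m₃₂ : |u₃ - v₂| ≤ A₃ - B₂) (m₄₂ : |u₄ - v₂| ≤ A₄ - B₂)
    (c₁ : u₁ < v₁) (c₂ : v₁ < u₂) (c₃ : v₁ < u₃)
    (d₂ : u₂ < v₂) (d₃ : u₃ < v₂) (d₄ : v₂ < u₄) :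
    0 ≤ (1 / 2) * ((A₁ ^ 2 + A₂ ^ 2 + A₃ ^ 2 + A₄ ^ 2) - (B₁ ^ 2 + B₂ ^ 2)) * ((u₁ ^ 2 + u₂ ^ 2 + u₃ ^ 2 + u₄ ^ 2) - (v₁ ^ 2 + v₂ ^ 2))
        + ((A₁ * u₁ + A₂ * u₂ + A₃ * u₃ + A₄ * u₄) - (B₁ * v₁ + B₂ * v₂)) ^ 2
        - 3 * ((A₁ ^ 2 * u₁ ^ 2 + A₂ ^ 2 * u₂ ^ 2 + A₃ ^ 2 * u₃ ^ 2 + A₄ ^ 2 * u₄ ^ 2) - (B₁ ^ 2 * v₁ ^ 2 + B₂ ^ 2 * v₂ ^ 2))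
      + (3 * ((u₁ ^ 4 + u₂ ^ 4 + u₃ ^ 4 + u₄ ^ 4) - (v₁ ^ 4 + v₂ ^ 4)) - (3 / 2) * ((u₁ ^ 2 + u₂ ^ 2 + u₃ ^ 2 + u₄ ^ 2) - (v₁ ^ 2 + v₂ ^ 2)) ^ 2) := by
  have ha₁ : 0 ≤ A₁ - B₁ := le_trans (abs_nonneg _) m₁₁
  have ha₂ : 0 ≤ A₂ - B₁ := le_trans (abs_nonneg _) m₂₁
  have ha₃ : 0 ≤ A₃ - B₁ := le_trans (abs_nonneg _) m₃₁
  have ha₄ : 0 ≤ A₄ - B₁ := le_trans (abs_nonneg _) m₄₁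
  have ha₁' : 0 ≤ A₁ - B₂ := le_trans (abs_nonneg _) m₁₂
  have ha₂' : 0 ≤ A₂ - B₂ := le_trans (abs_nonneg _) m₂₂
  have ha₃' : 0 ≤ A₃ - B₂ := le_trans (abs_nonneg _) m₃₂
  have ha₄' : 0 ≤ A₄ - B₂ := le_trans (abs_nonneg _) m₄₂
  have hQ2 := Q2_eq_F1 A₁ A₂ A₃ A₄ B₁ B₂ u₁ u₂ u₃ u₄ v₁ v₂ hA hC
  have hQ4 := Q4_eq_F1 u₁ u₂ u₃ u₄ v₁ v₂ hC
  have hQ2' := Q2_eq_F2 A₁ A₂ A₃ A₄ B₁ B₂ u₁ u₂ u₃ u₄ v₁ v₂ hA hC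
  have hQ4' := Q4_eq_F2 u₁ u₂ u₃ u₄ v₁ v₂ hC
  have hK1 := K1_F1_sub_K1_F2 A₁ A₂ A₃ A₄ B₁ B₂ u₁ u₂ u₃ u₄ v₁ v₂ hA hC
  rw [hP1, hP2] at hQ2 hQ2'
  rw [hP2, hP4] at hK1
  rw [hP4] at hQ4 hQ4'
  by_cases hbr : (v₁ - u₁) * ((A₄ - B₁) * (u₂ - v₁) * (u₃ - v₁) + (A₃ - B₁) * (u₂ - v₁) * (u₄ - v₁) + (A₂ - B₁) * (u₃ - v₁) * (u₄ - v₁))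
      ≤ (A₁ - B₁) * ((u₂ - v₁) * (u₃ - v₁) * (u₄ - v₁))
  · -- branch K₁(F₁) ≥ 0: work from F₁ (E₁ is the lone E-charge below v₁)
    have hK2 := aX_sub_uW_nonneg (A₁ - B₁) (A₂ - B₁) (A₃ - B₁) (A₄ - B₁) (v₁ - u₁) (u₂ - v₁) (u₃ - v₁) (u₄ - v₁)
      (by linarith) (by linarith) (by linarith) (by linarith) ha₂ ha₃ ha₄ hbr
    have hB : 0 ≤ (v₁ - u₁) * ((u₂ - v₁) * (u₃ - v₁) * (u₄ - v₁)) := by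
      have : 0 < (u₂ - v₁) * (u₃ - v₁) * (u₄ - v₁) := by
        have h23 : 0 < (u₂ - v₁) * (u₃ - v₁) := mul_pos (by linarith) (by linarith)
        exact mul_pos h23 (by linarith)
      exact mul_nonneg (by linarith) this.le
    have key : 0 ≤ 2 * ((A₁ - B₁) * ((A₄ - B₁) * (u₂ - v₁) * (u₃ - v₁) + (A₃ - B₁) * (u₂ - v₁) * (u₄ - v₁) + (A₂ - B₁) * (u₃ - v₁) * (u₄ - v₁))
        - (v₁ - u₁) * ((A₃ - B₁) * (A₄ - B₁) * (u₂ - v₁) + (A₂ - B₁) * (A₄ - B₁) * (u₃ - v₁) + (A₂ - B₁) * (A₃ - B₁) * (u₄ - v₁)))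
        + 12 * ((v₁ - u₁) * ((u₂ - v₁) * (u₃ - v₁) * (u₄ - v₁))) := by linarith [hK2, hB]
    rw [hQ2, hQ4]
    convert key using 1
    ring
  · -- branch K₁(F₁) < 0: then K₁(F₂) < 0; work from F₂ (E₄ is the lone E-charge above v₂)
    push Not at hbr
    have e1 : (A₁ - B₁) * (u₂ - v₁) * (u₃ - v₁) * (u₄ - v₁)
      + (A₂ - B₁) * (u₁ - v₁) * (u₃ - v₁) * (u₄ - v₁)
      + (A₃ - B₁) * (u₁ - v₁) * (u₂ - v₁) * (u₄ - v₁)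
      + (A₄ - B₁) * (u₁ - v₁) * (u₂ - v₁) * (u₃ - v₁)
        = (A₁ - B₁) * ((u₂ - v₁) * (u₃ - v₁) * (u₄ - v₁))
          - (v₁ - u₁) * ((A₄ - B₁) * (u₂ - v₁) * (u₃ - v₁) + (A₃ - B₁) * (u₂ - v₁) * (u₄ - v₁) + (A₂ - B₁) * (u₃ - v₁) * (u₄ - v₁)) := by
      ring
    have e2 : (A₁ - B₂) * (u₂ - v₂) * (u₃ - v₂) * (u₄ - v₂)
      + (A₂ - B₂) * (u₁ - v₂) * (u₃ - v₂) * (u₄ - v₂)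
      + (A₃ - B₂) * (u₁ - v₂) * (u₂ - v₂) * (u₄ - v₂)
      + (A₄ - B₂) * (u₁ - v₂) * (u₂ - v₂) * (u₃ - v₂)
        = (u₄ - v₂) * ((A₃ - B₂) * (v₂ - u₁) * (v₂ - u₂) + (A₂ - B₂) * (v₂ - u₁) * (v₂ - u₃) + (A₁ - B₂) * (v₂ - u₂) * (v₂ - u₃))
          - (A₄ - B₂) * ((v₂ - u₁) * (v₂ - u₂) * (v₂ - u₃)) := by
      ring
    have hbr' : (u₄ - v₂) * ((A₃ - B₂) * (v₂ - u₁) * (v₂ - u₂) + (A₂ - B₂) * (v₂ - u₁) * (v₂ - u₃) + (A₁ - B₂) * (v₂ - u₂) * (v₂ - u₃))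
        ≤ (A₄ - B₂) * ((v₂ - u₁) * (v₂ - u₂) * (v₂ - u₃)) := by
      linarith [hK1, hbr, e1, e2]
    have hK2 := aX_sub_uW_nonneg (A₄ - B₂) (A₁ - B₂) (A₂ - B₂) (A₃ - B₂) (u₄ - v₂) (v₂ - u₁) (v₂ - u₂) (v₂ - u₃)
      (by linarith) (by linarith) (by linarith) (by linarith) ha₁' ha₂' ha₃' hbr'
    have hB : 0 ≤ (u₄ - v₂) * ((v₂ - u₁) * (v₂ - u₂) * (v₂ - u₃)) := by
      have : 0 < (v₂ - u₁) * (v₂ - u₂) * (v₂ - u₃) := by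
        have h12 : 0 < (v₂ - u₁) * (v₂ - u₂) := mul_pos (by linarith) (by linarith)
        exact mul_pos h12 (by linarith)
      exact mul_nonneg (by linarith) this.le
    have key : 0 ≤ 2 * ((A₄ - B₂) * ((A₃ - B₂) * (v₂ - u₁) * (v₂ - u₂) + (A₂ - B₂) * (v₂ - u₁) * (v₂ - u₃) + (A₁ - B₂) * (v₂ - u₂) * (v₂ - u₃))
        - (u₄ - v₂) * ((A₂ - B₂) * (A₃ - B₂) * (v₂ - u₁) + (A₁ - B₂) * (A₃ - B₂) * (v₂ - u₂) + (A₁ - B₂) * (A₂ - B₂) * (v₂ - u₃)))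
        + 12 * ((u₄ - v₂) * ((v₂ - u₁) * (v₂ - u₂) * (v₂ - u₃))) := by linarith [hK2, hB]
    rw [hQ2', hQ4']
    convert key using 1
    ring


end Summit.HodgeConjecture.HodgeConjecture.WeilClassTestFormatFourTwo
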